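import Literature.NumberTheory.EllipticCurves.TwoTorsionOddDegreeBaseChangeProofs
import Literature.NumberTheory.EllipticCurves.HeegnerPoints
import HarnessLib

/-!
# Route `KolyvaginRankRigidityAtTwo`, crux 27123 `OffHabitatIrredNonSurjTwoConverse` (LINE 8 «margin absorbs index»,
# skeleton `MarginAbsorbsIndex`): stub `stub_noTwoTorsionOverK_of_irred` — `E(ℚ)[2] = 0 ⟹ E(K)[2] = 0` for every
# imaginary quadratic `K`

Cell `bsd-2adic`, seat `bsd-2adic-conv-1` (GEN 20; S3's off-habitat remit — the `E(ℚ)[2] = 0` strata of the leaf's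
off-habitat complement are 27123's habitat).  THEOREMS ONLY — no definition, no named fact, no `sorry`;
`--supports stmt-BirchSwinnertonDyer-27123`.  HONEST FRAMING: an elementary stub (Gross admissibility off the
surjective habitat); the crux 27123 and its Kolyvagin stubs V1fin / V2fin stay OPEN; BSD is not proved by this.

The registered signature, proved verbatim: if `E(ℚ)` has no point of order `2` (`AddSubgroup.torsionBy E(ℚ) 2 = ⊥`),
then for every imaginary quadratic field `K`, `E(K)` has none either.  Printed one-line argument (Silverman, *AEC*,
Ex. III.3.7 (d)): the abscissa of a point of order `2` is a root of the `2`-division cubic; with no rational point of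
order `2` that cubic is irreducible over `ℚ`, so a root generates a cubic field and `3 ∣ [K : ℚ] = 2` is absurd —
the tree's `WeierstrassCurve.forall_two_nsmul_baseChange_of_finrank_eq_two` (file
`TwoTorsionOddDegreeBaseChangeProofs`, which treated the surjective-`ρ̄₂` habitat; here only `E(ℚ)[2] = 0` is used,
covering the `C₃`-image stratum as well).

References: J. H. Silverman, *AEC* (2009), III.§1 and Ex. III.3.7 (d) [SilvermanAEC2009]; B. Gross, *Kolyvagin's work
on modular elliptic curves* (1991), §2 (the hypothesis `E(K)[p] = 0`) [GrossLMS1991].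
-/

set_option autoImplicit false
-- the Theorems namespace of this sub repeats the summit name by design (D-0017 nested layout)
set_option linter.dupNamespace false

noncomputable section

open scoped Classical

open WeierstrassCurve Literature.NumberTheory.EllipticCurves

namespace Summit.BirchSwinnertonDyer.BirchSwinnertonDyer.Theorems.KolyvaginRankRigidity

/-- `A[2] = ⊥` (the `AddSubgroup.torsionBy` currency) iff the abelian group `A` has no element of order `2`
(`2 • P = 0 → P = 0`). [folklore] -/
theorem torsionBy_two_eq_bot_iff_forall_two_nsmul {A : Type*} [AddCommGroup A] :
    AddSubgroup.torsionBy A (2 : ℤ) = ⊥ ↔ ∀ P : A, 2 • P = 0 → P = 0 := by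
  rw [eq_bot_iff]
  constructor
  · intro h P hP
    have hmem : P ∈ AddSubgroup.torsionBy A (2 : ℤ) := (Submodule.mem_torsionBy_iff _ _).mpr (by
      change (2 : ℤ) • P = 0
      rw [show (2 : ℤ) = ((2 : ℕ) : ℤ) from rfl, natCast_zsmul]; exact hP)
    exact (AddSubgroup.mem_bot).mp (h hmem)
  · intro h P hP
    have h2 : (2 : ℤ) • P = 0 := (Submodule.mem_torsionBy_iff _ _).mp hP
    rw [show (2 : ℤ) = ((2 : ℕ) : ℤ) from rfl, natCast_zsmul] at h2
    exact (AddSubgroup.mem_bot).mpr (h P h2)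

/-- **Stub `stub_noTwoTorsionOverK_of_irred` of crux 27123 (skeleton `MarginAbsorbsIndex`), registered signature
verbatim**: `E(ℚ)[2] = 0 ⟹ E(K)[2] = 0` for every imaginary quadratic `K` — no new `2`-torsion in a quadratic
extension, since the `2`-division cubic without rational root is irreducible and `3 ∤ 2`.  (`convert` bridges
Mathlib's two `DecidableEq ℚ` instances behind the group law on `E(ℚ)`.)
[cite: SilvermanAEC2009, Ex. III.3.7 (d)] [cite: GrossLMS1991, §2] -/
theorem stub_noTwoTorsionOverK_of_irred :
    ∀ (W : WeierstrassCurve ℚ) [W.IsElliptic], AddSubgroup.torsionBy W.toAffine.Point (2 : ℤ) = ⊥ →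
      ∀ (K : Type) [Field K] [NumberField K], Literature.NumberTheory.EllipticCurves.IsImaginaryQuadratic K →
        AddSubgroup.torsionBy (W.baseChange K).toAffine.Point (2 : ℤ) = ⊥ := by
  intro W _ hW K _ _ hK
  rw [torsionBy_two_eq_bot_iff_forall_two_nsmul] at hW ⊢
  intro P hP
  have h := W.forall_two_nsmul_baseChange_of_finrank_eq_two (L := K) two_ne_zero
    (fun Q hQ ↦ hW Q (by convert hQ)) hK.1 P (by convert hP)
  exact h

/-- The same for ANY field `K` of characteristic `0` with `3 ∤ [K : ℚ]` (quadratic, quartic, …), hypothesis in the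
`∀ P, 2 • P = 0 → P = 0` form: `E(K)[2] = ⊥`. [cite: SilvermanAEC2009, Ex. III.3.7 (d)] -/
theorem torsionBy_two_baseChange_eq_bot_of_forall_two_nsmul_of_not_three_dvd (W : WeierstrassCurve ℚ)
    [W.IsElliptic] (hW : ∀ P : W.toAffine.Point, 2 • P = 0 → P = 0) (K : Type*) [Field K] [CharZero K]
    (hK : ¬ 3 ∣ Module.finrank ℚ K) : AddSubgroup.torsionBy (W.baseChange K).toAffine.Point (2 : ℤ) = ⊥ := by
  rw [torsionBy_two_eq_bot_iff_forall_two_nsmul]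
  intro P hP
  have h := W.forall_two_nsmul_baseChange_of_not_three_dvd_finrank (L := K) two_ne_zero
    (fun Q hQ ↦ hW Q (by convert hQ)) hK P (by convert hP)
  exact h

end Summit.BirchSwinnertonDyer.BirchSwinnertonDyer.Theorems.KolyvaginRankRigidity

end
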